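/-
Copyright (c) 2026 the pub-hodgecm-mathlib formalisation cell (harness21).  Prover seat hodgecm-mathlib-R90-C10-p08 (g2), SLAB R90-TF, section S1 «Ch. 10∕12 local»;
crux H413 = `stmt-HodgeConjecture-24833`; line (D-1) «B_pos» of U4Keys :182 ∕ (S-RT), card (B-10)(5) (R90-C10-plan (g2) R-S1-22 ∕ AMENDED 01:22:49Z); PAPER P-ram-1
`R90/R90-C10-p08/g2/PAPER-Pram1-GaussSumEntries.md` 1fba7ee70e95cdc9 §1 (P1)(P3), reconciled with p01 (g3)'s cross 285001636e231ee7 §2 «KEY COSET STEP».  KERNEL module: THEOREMS ONLY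
(no definition, no named fact, no `sorry`, no instance, no notation).  2026-09-05.
-/
import Summits.HodgeConjecture.HodgeConjecture.Theorems.R90S1BposSkewLineCharacterIntegralDepth   -- ★ p863275 (B-4) PART 2 (R90-C10-p04 (g2)) + ★ PART 1 tools (§1 orthogonality, §2 product decomposition)
import HarnessLib

/-!
# R90-TF S1 «Ch10-local» ∕ K2 E3 «U4Keys» :182, BRANCH B AT POSITIVE DEPTH — brick (B-10)(5): THE COSET VANISHING ON THE SKEW LINE
# «`∫_{y ∈ R⁻, |y − t₀|_w ≤ |r|} χ₁((1 + y)^) dμ⁻ = 0` for EVERY skew centre `t₀` (`|t₀|_w ≤ 1`) once `χ₁` is non-trivial at level `r`» — the Cayley-coset step of PAPER P-ram-1 (shells `m ≤ n − 3` VANISH) [Keys1984 §7 Thm (2); WeilBNT1967 Ch. II §5]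

Cell `pub/hodgecm-mathlib`, crux H413 = `stmt-HodgeConjecture-24833`, route of record `HCCMUnconditional` (no route verbs); R90-TF section S1.  THEOREMS ONLY; lane `--supports
stmt-HodgeConjecture-24833 --as helper`, count-neutral.  NOT THE PAYER of :182.
WHAT.  In the tame RAMIFIED positive-depth corner (PAPER P-ram-1 §1–§2 = p01 (g3)'s cross §2) the odd shell `|z| = q^{2κ+1}` of the big-cell entries reduces to integrals of `E(1 + t)`,
`E = χ₁∘unit`, over the skew SPHERE `S⁻_m`, weighted in the sub-branch (R-b) by a sign that is constant on the cosets `t₀ + E⁻_{m+2}`; the census's OWED item «do the shells `m ≤ n−3`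
vanish?» is answered YES by the COSET VANISHING: `∫_{t₀ + E⁻_{m+2}} E(1 + t) dμ⁻(t) = 0` whenever `χ₁` is non-trivial at level `m + 2` (i.e. `m + 2 ≤ n − 1`).  Paper mechanism (memo
§1 (P1)): `Ψ(t) := χ₁(1+t)` is a character of `(E⁻_1, ⊕)`, `t ⊕ t' = (t + t')∕(1 + tt')` (★ p863838 kills `1 + tt' ∈ 1 + 𝔭_F`), ⊕-cosets = additive cosets, orthogonality.  LEAN ROUTE
(this file): the ★ p863275 machinery VERBATIM on the TRANSLATED level set `A = {b ∈ R : |b − (1 + t₀)|_w ≤ |ρ|_w}` — it is `u₀`-invariant for every unit `u₀` of level `ρ`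
(`u₀b − (1+t₀) = u₀(b − (1+t₀)) + (u₀ − 1)(1 + t₀)`, `|1 + t₀|_w = 1`), it is the product `P × Y` of `P = {a ∈ R⁺ : |a − 1| ≤ |ρ|}` and the translated skew ball `Y = {y ∈ R⁻ : |y − t₀| ≤ |ρ|}`
(`|(a − 1) + (y − t₀)| = max`, ★ `valued_add_apply_eq_max`), and the fibre over a PRINCIPAL fixed `a ∈ P` is the fibre over `1` (`E(a + y) = E(1 + â⁻¹y)` by `hfixP`, and `y ↦ â⁻¹y` maps
`Y` onto itself because `|(â⁻¹ − 1)t₀| ≤ |ρ|`) — so `0 = ∫_A E = μ⁺(P)·∫_Y E(1 + y) dμ⁻` with `0 < μ⁺(P) < ∞`.  At `t₀ = 0` this is ★∕📤 (5a) `R90S1BposRamSkewBallCharacterIntegral` §2; the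
letter is `hfixP` «`χ₁ = 1` on the `σ`-fixed PRINCIPAL units» (★ p863838 §1 partially applied; inert AND tame ramified, (R-a) and (R-b)).  No `⊕` appears in the Lean statements.
* §1 **`dite_one_add_add_eq_of_trivial`** — LOCAL CONSTANCY: `E(1 + t₀ + t) = E(1 + t₀)` for skew `t₀` (`|t₀|_w ≤ 1`) and `|t_w| ≤ |ρ|_w` when `χ₁` is trivial at level `ρ` (the
  conductor; letter `htriv` of ★ p863275 (ii)) — the pointwise input of (6a) `R90S1BposRamGaussSphere` (p04) and (6b) `R90S1BposRamShells` (p07).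
* §2 **`setIntegral_skewBallTranslate_dite_add_eq_of_fixedPrincipal`** — the fibre over a principal fixed `a` on the translated ball equals the fibre over `1`.
* §3 **`setIntegral_skewBallTranslate_dite_one_add_eq_zero_of_level_of_fixedPrincipal`** — THE COSET VANISHING; radius `r ∈ L_w` (`0 < |r| < 1`).
* §4 **`setIntegral_skewBallTranslate_pow_dite_one_add_eq_zero`** (+ `…diteInv…`) — the same at radius `|Π|ᵐ` with ★ p863496's witness letters `u₁ hu₁ hχu₁` (C-pack currency).
HONEST LABEL.  HC_CM is proved only modulo the 7 printed citations (2 remaining named inputs: hLiu418 = `stmt-HodgeConjecture-24832`, h413 = `stmt-HodgeConjecture-24833`) until rung 0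
closes; count-neutral — pays NO socket (:182, (S-RT), A2′ OPEN); no printed citation discharged; wild corner (`v ∣ 2`) not addressed.  Credit: skeleton = R90-C10-p04 (g2)'s ★ p863275.

## References
* [Keys1984] D. Keys, *Principal series representations of special unitary groups over local fields*, Compositio Math. 51 (1984), §4–§5; §7 Theorem (2) p. 126.
* [WeilBNT1967] A. Weil, *Basic Number Theory*, Grundlehren 144 (1967), Ch. II §5.
* [Roche1998] A. Roche, *Types and Hecke algebras for principal series representations of split reductive p-adic groups*, Ann. Sci. ÉNS (4) 31 (1998), §3–§4.
-/

set_option autoImplicit false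
-- the mandated namespace has the single-problem summit's repeated segment (`HodgeConjecture.HodgeConjecture`)
set_option linter.dupNamespace false

noncomputable section

open NumberField IsDedekindDomain MeasureTheory Measure Topology Set
open scoped NNReal ENNReal
open Literature.NumberTheory Literature.NumberTheory.Automorphic Literature.NumberTheory.Automorphic.UnitaryGroup

namespace Summit.HodgeConjecture.HodgeConjecture.R90.S1.BposRamSkewLineCayley

open Summit.HodgeConjecture.HodgeConjecture.Cruxes.H413
open Summit.HodgeConjecture.HodgeConjecture.Cruxes.H413.K2E3BranchBSkewUnitSign
open Summit.HodgeConjecture.HodgeConjecture.Cruxes.H413.K2E3BranchBSkewLineIntegrals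
open Summit.HodgeConjecture.HodgeConjecture.Cruxes.H413.K2E3BranchBSkewLineCharacterIntegral
open Summit.HodgeConjecture.HodgeConjecture.R90.S1.BposSkewBallCharacterTools
open Summit.HodgeConjecture.HodgeConjecture.R90.S1.BposSkewLineCharacterIntegralDepth

variable (L : Type) [Field L] [NumberField L] [IsCMField L] (v : HeightOneSpectrum (𝓞 ↥(maximalRealSubfield L)))
  (w : PlacesOver L v) (hw : IsCMField.complexConj L • w.1 = w.1)

/-! ## §1 Local constancy of `E(1 + ·)` on the skew line at the scale of the conductor -/

open scoped Classical in
include hw in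
/-- **`E(1 + t₀ + t) = E(1 + t₀)`** for a skew `t₀` with `|t₀|_w ≤ 1` and any `t` with `|t_w| ≤ |ρ|_w < 1`, when `χ₁ u = 1` for every unit `u` with `|(u − 1)_w| ≤ |ρ|_w` (`htriv`, the
conductor letter of ★ p863275 (ii); `|2|_w = 1`): `1 + t₀` is a unit (`|1 + t₀|_w = max(1, |t₀|_w) = 1`, ★ `valued_add_apply_eq_max`), and `u := (1 + t₀ + t)·(1 + t₀)⁻¹` has
`|u − 1|_w = |t|_w ≤ |ρ|_w`.  (PAPER P-ram-1 §1 (P3): on `S⁻_{n−1}` the integrand is constant on the cosets of `E⁻_{n+1}`; p01 cross §2 «`χ₁(1 − u₀τ)⁻¹ = ψ₀(−c̄₀τ̄)`».)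
[cite: Keys1984, §4, §7 Theorem (2) p. 126] [cite: WeilBNT1967, Ch. II §5] -/
theorem dite_one_add_add_eq_of_trivial (h2w : Valued.v (2 : w.1.adicCompletion L) = 1) (χ₁ : (LocalRing L v)ˣ →* ℂˣ)
    (r : w.1.adicCompletion L) (hr1 : Valued.v r < 1)
    (htriv : ∀ u : (LocalRing L v)ˣ, Valued.v (((u : LocalRing L v) - 1) w) ≤ Valued.v r → χ₁ u = 1)
    {t₀ : LocalRing L v} (ht₀ : conjLocal L (IsCMField.complexConj L) v t₀ = -t₀) (ht₀1 : Valued.v (t₀ w) ≤ 1)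
    {t : LocalRing L v} (ht : Valued.v (t w) ≤ Valued.v r) :
    (fun r : LocalRing L v => if h : IsUnit r then ((χ₁ h.unit : ℂˣ) : ℂ) else 0) (1 + t₀ + t) =
      (fun r : LocalRing L v => if h : IsUnit r then ((χ₁ h.unit : ℂˣ) : ℂ) else 0) (1 + t₀) := by
  letI : Invertible (2 : LocalRing L v) := (isUnit_two_localRing L v).invertible
  -- `|1 + t₀|_w = 1`, `|1 + t₀ + t|_w = 1`: both are units
  have h10 : Valued.v ((1 + t₀) w) = 1 := by
    rw [valued_add_apply_eq_max L v w hw h2w (by rw [map_one]) ht₀, Pi.one_apply, map_one, max_eq_left ht₀1]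
  have ht1 : Valued.v (t w) < 1 := lt_of_le_of_lt ht hr1
  have h1t : Valued.v ((1 + t₀ + t) w) = 1 := by
    have hlt : Valued.v (t w) < Valued.v ((1 + t₀) w) := by rw [h10]; exact ht1
    rw [Pi.add_apply, Valuation.map_add_eq_of_lt_left _ hlt, h10]
  have hU0 : IsUnit (1 + t₀) :=
    K2E3DepthZeroIwahoriCharacterCM.isUnit_of_apply_ne_zero L v w hw _ (fun h => by rw [h, map_zero] at h10; exact zero_ne_one h10)
  have hU1 : IsUnit (1 + t₀ + t) :=
    K2E3DepthZeroIwahoriCharacterCM.isUnit_of_apply_ne_zero L v w hw _ (fun h => by rw [h, map_zero] at h1t; exact zero_ne_one h1t)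
  simp only [dif_pos hU0, dif_pos hU1]
  -- `u := (1 + t₀ + t)(1 + t₀)⁻¹` has level `ρ`
  set u : (LocalRing L v)ˣ := hU1.unit * hU0.unit⁻¹ with hu
  have hu1 : Valued.v (((u : LocalRing L v) - 1) w) ≤ Valued.v r := by
    have hinv := units_apply_mul_inv_apply L v hU0.unit w
    rw [IsUnit.unit_spec] at hinv
    have h : ((u : LocalRing L v) - 1) w = t w * (((hU0.unit⁻¹ : (LocalRing L v)ˣ) : LocalRing L v) w) := by
      rw [hu, Units.val_mul, IsUnit.unit_spec, Pi.sub_apply, Pi.mul_apply, Pi.one_apply]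
      have e : (1 + t₀ + t) w = (1 + t₀) w + t w := by rw [Pi.add_apply]
      rw [e, add_mul, hinv]; ring
    rw [h, map_mul, valued_units_inv_apply_eq_one L v (by rw [IsUnit.unit_spec]; exact h10), mul_one]
    exact ht
  have hfac : hU1.unit = u * hU0.unit := by rw [hu, inv_mul_cancel_right]
  rw [hfac, map_mul, htriv u hu1, one_mul]

section SkewBallTranslate

variable [MeasurableSpace (LocalRing L v)] [BorelSpace (LocalRing L v)]
  (μY : Measure ↥(HeisRing.skewPart (conjLocal L (IsCMField.complexConj L) v))) [μY.IsAddHaarMeasure] [μY.Regular]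

/-! ## §2 The fibre over a principal fixed `a` on a TRANSLATED skew ball equals the fibre over `1` -/

open scoped Classical in
include hw in
/-- **`∫_{|y − t₀|_w ≤ |ρ|_w} E(a + y) dμ⁻ = ∫_{|y − t₀|_w ≤ |ρ|_w} E(1 + y) dμ⁻`** for a `σ`-fixed PRINCIPAL `a` (`|a − 1|_w ≤ |ρ|_w < 1`), ANY centre `t₀` with `|t₀|_w ≤ 1` (skewness not needed here), `|2|_w = 1`,
under `hfixP`.  ★ PART 1 §3 `setIntegral_skewBall_dite_add_eq_of_fixed` token for token on the translated ball: `E(a + y) = χ₁(â)·E(1 + â⁻¹y) = E(1 + â⁻¹y)` (`hfixP â`), and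
`y ↦ â⁻¹y` (★ `HeisRing.smulSkew`, `μ⁻`-preserving) maps the translated ball onto itself because `â⁻¹y − t₀ = â⁻¹(y − t₀) + (â⁻¹ − 1)t₀` with `|â⁻¹ − 1|_w ≤ |ρ|_w`, `|t₀|_w ≤ 1`.
[cite: Keys1984, §4, §7 Theorem (2) p. 126] [cite: WeilBNT1967, Ch. II §5] -/
theorem setIntegral_skewBallTranslate_dite_add_eq_of_fixedPrincipal (h2w : Valued.v (2 : w.1.adicCompletion L) = 1) (χ₁ : (LocalRing L v)ˣ →* ℂˣ)
    (hfixP : ∀ u : (LocalRing L v)ˣ, (∀ w' : PlacesOver L v, Valued.v (((u : LocalRing L v) w') - 1) < 1) →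
      conjLocal L (IsCMField.complexConj L) v (u : LocalRing L v) = u → χ₁ u = 1)
    (r : w.1.adicCompletion L) (hr1 : Valued.v r < 1) {t₀ : LocalRing L v} (ht₀1 : Valued.v (t₀ w) ≤ 1)
    {a : LocalRing L v} (ha : conjLocal L (IsCMField.complexConj L) v a = a) (ha1 : Valued.v ((a - 1) w) ≤ Valued.v r) :
    ∫ y in {y : ↥(HeisRing.skewPart (conjLocal L (IsCMField.complexConj L) v)) | Valued.v (((y : LocalRing L v) - t₀) w) ≤ Valued.v r},
        (fun r : LocalRing L v => if h : IsUnit r then ((χ₁ h.unit : ℂˣ) : ℂ) else 0) (a + (y : LocalRing L v)) ∂μY =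
      ∫ y in {y : ↥(HeisRing.skewPart (conjLocal L (IsCMField.complexConj L) v)) | Valued.v (((y : LocalRing L v) - t₀) w) ≤ Valued.v r},
        (fun r : LocalRing L v => if h : IsUnit r then ((χ₁ h.unit : ℂˣ) : ℂ) else 0) (1 + (y : LocalRing L v)) ∂μY := by
  letI : Invertible (2 : LocalRing L v) := (isUnit_two_localRing L v).invertible
  haveI : SecondCountableTopology (LocalRing L v) := secondCountableTopology_localRing (E := L) v
  have hσ := conjLocal_conjLocal_cm L v
  have hσc := continuous_conjLocal L (IsCMField.complexConj L) v
  -- `a` is a principal unit: `|a_w| = 1`, `|a_w − 1| < 1`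
  have halt : Valued.v ((a - 1) w) < 1 := lt_of_le_of_lt ha1 hr1
  have hav : Valued.v (a w) = 1 := by
    have h : a w = 1 + (a - 1) w := by rw [Pi.sub_apply, Pi.one_apply, add_sub_cancel]
    rw [h]; exact Valuation.map_one_add_of_lt _ halt
  -- the unit `â` and its inverse
  have haU : IsUnit a := K2E3DepthZeroIwahoriCharacterCM.isUnit_of_apply_ne_zero L v w hw a (fun h => by rw [h, map_zero] at hav; exact zero_ne_one hav)
  set â : (LocalRing L v)ˣ := haU.unit with hâ
  have hâa : (â : LocalRing L v) = a := haU.unit_spec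
  have hâfix : conjLocal L (IsCMField.complexConj L) v (â : LocalRing L v) = â := by rw [hâa]; exact ha
  have hâinvfix : conjLocal L (IsCMField.complexConj L) v (((â⁻¹ : (LocalRing L v)ˣ)) : LocalRing L v) = ((â⁻¹ : (LocalRing L v)ˣ) : LocalRing L v) :=
    HeisRing.map_units_inv_of_fixed (conjLocal L (IsCMField.complexConj L) v) â hâfix
  have hâv : Valued.v ((â : LocalRing L v) w) = 1 := by rw [hâa]; exact hav
  have hâinvv : Valued.v (((â⁻¹ : (LocalRing L v)ˣ) : LocalRing L v) w) = 1 := valued_units_inv_apply_eq_one L v hâv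
  have hâ1 : Valued.v (((â : LocalRing L v) - 1) w) ≤ Valued.v r := by rw [hâa]; exact ha1
  have hâinv1 : Valued.v ((((â⁻¹ : (LocalRing L v)ˣ) : LocalRing L v) - 1) w) ≤ Valued.v r := by
    have h : (((â⁻¹ : (LocalRing L v)ˣ) : LocalRing L v) - 1) w = -((((â⁻¹ : (LocalRing L v)ˣ) : LocalRing L v) w) * (((â : LocalRing L v) - 1) w)) := by
      have h1 := units_apply_mul_inv_apply L v â w
      simp only [Pi.sub_apply, Pi.one_apply]
      linear_combination h1
    rw [h, Valuation.map_neg, map_mul, hâinvv, one_mul]; exact hâ1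
  -- `hfixP` at the principal fixed unit `â`
  have hχâ : χ₁ â = 1 := hfixP â (forall_placesOver_of_apply L v w hw (by rw [hâa]; exact halt)) hâfix
  -- multiplication by a unit of level `ρ` preserves the translated ball
  have hstepT : ∀ u : (LocalRing L v)ˣ, Valued.v ((u : LocalRing L v) w) = 1 → Valued.v (((u : LocalRing L v) - 1) w) ≤ Valued.v r →
      ∀ y : LocalRing L v, Valued.v ((y - t₀) w) ≤ Valued.v r → Valued.v (((u : LocalRing L v) * y - t₀) w) ≤ Valued.v r := fun u hu1 hul y hy => by
    have h : ((u : LocalRing L v) * y - t₀) w = (u : LocalRing L v) w * ((y - t₀) w) + ((u : LocalRing L v) - 1) w * t₀ w := by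
      simp only [Pi.sub_apply, Pi.mul_apply, Pi.one_apply]; ring
    rw [h]; refine (Valuation.map_add _ _ _).trans (max_le ?_ ?_)
    · rw [map_mul, hu1, one_mul]; exact hy
    · rw [map_mul]; exact (mul_le_mul' hul ht₀1).trans_eq (mul_one _)
  set B : Set ↥(HeisRing.skewPart (conjLocal L (IsCMField.complexConj L) v)) :=
    {y | Valued.v (((y : LocalRing L v) - t₀) w) ≤ Valued.v r} with hBdef
  have hmeasB : MeasurableSet B := by
    have h : B = (fun y : ↥(HeisRing.skewPart (conjLocal L (IsCMField.complexConj L) v)) => ((y : LocalRing L v) - t₀) w) ⁻¹'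
        {z : w.1.adicCompletion L | Valued.v z ≤ Valued.v r} := rfl
    rw [h]
    exact ((isClosed_setOf_valued_le_valued L v w r).preimage ((continuous_apply w).comp (continuous_subtype_val.sub continuous_const))).measurableSet
  -- (i) the integrand: `χ₁((a + y)^) = χ₁((1 + a⁻¹ y)^)` on the translated ball (only `|y|_w ≤ 1` is used)
  have hpt : ∀ y ∈ B,
      (fun r : LocalRing L v => if h : IsUnit r then ((χ₁ h.unit : ℂˣ) : ℂ) else 0) (a + (y : LocalRing L v)) =
        (fun r : LocalRing L v => if h : IsUnit r then ((χ₁ h.unit : ℂˣ) : ℂ) else 0) (1 + ((â⁻¹ : (LocalRing L v)ˣ) : LocalRing L v) * (y : LocalRing L v)) := by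
    intro y hy
    have hy1 : Valued.v ((y : LocalRing L v) w) ≤ 1 := by
      have e : (y : LocalRing L v) w = ((y : LocalRing L v) - t₀) w + t₀ w := by rw [Pi.sub_apply, sub_add_cancel]
      rw [e]; exact (Valuation.map_add _ _ _).trans (max_le (le_trans hy hr1.le) ht₀1)
    -- `1 + a⁻¹ y` has `|·|_w = 1`, so it is a unit
    have hskew' : conjLocal L (IsCMField.complexConj L) v (((â⁻¹ : (LocalRing L v)ˣ) : LocalRing L v) * (y : LocalRing L v)) =
        -(((â⁻¹ : (LocalRing L v)ˣ) : LocalRing L v) * (y : LocalRing L v)) := by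
      rw [map_mul, hâinvfix, (HeisRing.mem_skewPart_iff _ _).1 y.2, mul_neg]
    have hv1 : Valued.v ((1 + ((â⁻¹ : (LocalRing L v)ˣ) : LocalRing L v) * (y : LocalRing L v)) w) = 1 := by
      rw [valued_add_apply_eq_max L v w hw h2w (by rw [map_one]) hskew', Pi.one_apply, map_one, max_eq_left_iff, Pi.mul_apply, map_mul, hâinvv, one_mul]
      exact hy1
    have hU1 : IsUnit (1 + ((â⁻¹ : (LocalRing L v)ˣ) : LocalRing L v) * (y : LocalRing L v)) :=
      K2E3DepthZeroIwahoriCharacterCM.isUnit_of_apply_ne_zero L v w hw _ (fun h => by rw [h] at hv1; exact zero_ne_one (by rw [← hv1, map_zero]))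
    have hUa : IsUnit (a + (y : LocalRing L v)) := by
      have : a + (y : LocalRing L v) = (â : LocalRing L v) * (1 + ((â⁻¹ : (LocalRing L v)ˣ) : LocalRing L v) * (y : LocalRing L v)) := by
        rw [mul_add, mul_one, ← mul_assoc, Units.mul_inv, one_mul, hâa]
      rw [this]; exact haU.unit.isUnit.mul hU1
    simp only [dif_pos hUa, dif_pos hU1]
    have hunits : hUa.unit = â * hU1.unit := by
      apply Units.ext
      rw [hUa.unit_spec, Units.val_mul, hU1.unit_spec, mul_add, mul_one, ← mul_assoc, Units.mul_inv, one_mul, hâa]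
    rw [hunits, map_mul, hχâ, one_mul]
  rw [setIntegral_congr_fun hmeasB hpt]
  -- (ii) the substitution `y ↦ a⁻¹ y` (preserves `μ⁻` and the translated ball)
  set T := HeisRing.smulSkew (conjLocal L (IsCMField.complexConj L) v) (â⁻¹) hâinvfix with hT
  obtain ⟨δ, hδ⟩ := exists_conjLocal_skew_unit L v
  have hmod : HeisRing.skewModulus (conjLocal L (IsCMField.complexConj L) v) hσc (â⁻¹) hâinvfix = 1 := by
    rw [HeisRing.skewModulus_eq_sqrt (conjLocal L (IsCMField.complexConj L) v) hσ hσc δ hδ (â⁻¹) hâinvfix,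
      show distribHaarChar (LocalRing L v) â⁻¹ = unitModulusChar (LocalRing L v) â⁻¹ from rfl,
      unitModulusChar_eq_one_of_forall_v_eq_one L v â⁻¹ (forall_placesOver_of_apply L v w hw hâinvv), NNReal.sqrt_one]
  have hpres : MeasurePreserving T μY μY := by
    refine ⟨T.continuous.measurable, ?_⟩
    rw [hT, HeisRing.map_smulSkew_eq (conjLocal L (IsCMField.complexConj L) v) hσc (â⁻¹) hâinvfix μY, hmod, inv_one, one_smul]
  have hpre : T ⁻¹' B = B := by
    ext y
    rw [Set.mem_preimage, hBdef, Set.mem_setOf_eq, Set.mem_setOf_eq, hT, HeisRing.coe_smulSkew]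
    constructor
    · intro h
      have h' := hstepT â hâv hâ1 _ h
      rwa [← mul_assoc, Units.mul_inv, one_mul] at h'
    · exact hstepT â⁻¹ hâinvv hâinv1 _
  have key := hpres.setIntegral_preimage_emb T.toHomeomorph.measurableEmbedding
    (fun y : ↥(HeisRing.skewPart (conjLocal L (IsCMField.complexConj L) v)) =>
      (fun r : LocalRing L v => if h : IsUnit r then ((χ₁ h.unit : ℂˣ) : ℂ) else 0) (1 + (y : LocalRing L v))) B
  rw [hpre] at key
  rw [← key]
  rfl

/-! ## §3 THE COSET VANISHING: the character integral over a translated skew ball of level `ρ` vanishes -/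

open scoped Classical in
include hw in
/-- **THE COSET VANISHING — `∫_{y ∈ R⁻, |y − t₀|_w ≤ |ρ|_w} χ₁((1 + y)^) dμ⁻(y) = 0`** for every skew centre `t₀` with `|t₀|_w ≤ 1`, whenever `χ₁` is NON-TRIVIAL on the principal units of
level `ρ` (`u₀`: `|(u₀ − 1)_w| ≤ |ρ|_w`, `χ₁ u₀ ≠ 1`; `0 < |ρ|_w < 1`), `χ₁` continuous and trivial on the `σ`-fixed PRINCIPAL units (`hfixP`; Branch B at every place with `|2|_w = 1`:
★ p863838), `|2|_w = 1`, `μ⁻` any regular additive Haar measure on `R⁻`.  = PAPER P-ram-1 §1 (P3) «`m ≤ n−3`: `∫_{t₀ ⊕ E⁻_{m+2}} Ψ̄ = 0`» = p01 (g3) cross §2 «KEY COSET STEP»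
(`𝟙[m+2 ≥ n]`); at `t₀ = 0` it is LEMMA S ∕ (5a).  PROOF (★ p863275 (i) skeleton, R90-C10-p04 (g2)): the TRANSLATED level set `A = {b ∈ R : |b − (1 + t₀)|_w ≤ |ρ|_w}` is Borel,
made of units of absolute value one (`|1 + t₀|_w = 1`), `u₀`-INVARIANT (`u₀b − (1+t₀) = u₀(b − (1+t₀)) + (u₀−1)(1+t₀)`) ⟹ `∫_A E dμ_R = 0` (★ PART 1 §1); `A = P × Y` through
`R = R⁺ ⊕ R⁻` with `P = {|a − 1| ≤ |ρ|}`, `Y = {|y − t₀| ≤ |ρ|}` (★ `valued_add_apply_eq_max`, ★ PART 1 §2); the fibre over `a ∈ P` is `Φ := ∫_Y E(1 + y) dμ⁻` (§2) ⟹ `0 = μ⁺(P)·Φ`,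
`0 < μ⁺(P) < ∞`. [cite: Keys1984, §4–§5, §7 Theorem (2) p. 126] [cite: WeilBNT1967, Ch. II §5] [cite: Roche1998, §3–§4] -/
theorem setIntegral_skewBallTranslate_dite_one_add_eq_zero_of_level_of_fixedPrincipal (h2w : Valued.v (2 : w.1.adicCompletion L) = 1)
    (χ₁ : (LocalRing L v)ˣ →* ℂˣ) (h₁ : Continuous fun x => ((χ₁ x : ℂˣ) : ℂ))
    (hfixP : ∀ u : (LocalRing L v)ˣ, (∀ w' : PlacesOver L v, Valued.v (((u : LocalRing L v) w') - 1) < 1) →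
      conjLocal L (IsCMField.complexConj L) v (u : LocalRing L v) = u → χ₁ u = 1)
    (r : w.1.adicCompletion L) (hr0 : Valued.v r ≠ 0) (hr1 : Valued.v r < 1)
    {t₀ : LocalRing L v} (ht₀ : conjLocal L (IsCMField.complexConj L) v t₀ = -t₀) (ht₀1 : Valued.v (t₀ w) ≤ 1)
    (u₀ : (LocalRing L v)ˣ) (hu₀ : Valued.v (((u₀ : LocalRing L v) - 1) w) ≤ Valued.v r) (hχ : χ₁ u₀ ≠ 1) :
    ∫ y in {y : ↥(HeisRing.skewPart (conjLocal L (IsCMField.complexConj L) v)) | Valued.v (((y : LocalRing L v) - t₀) w) ≤ Valued.v r},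
        (fun r : LocalRing L v => if h : IsUnit r then ((χ₁ h.unit : ℂˣ) : ℂ) else 0) (1 + (y : LocalRing L v)) ∂μY = 0 := by
  letI : Invertible (2 : LocalRing L v) := (isUnit_two_localRing L v).invertible
  haveI : SecondCountableTopology (LocalRing L v) := secondCountableTopology_localRing (E := L) v
  have hσc := continuous_conjLocal L (IsCMField.complexConj L) v
  haveI := HeisRing.locallyCompactSpace_fixedPart (conjLocal L (IsCMField.complexConj L) v) hσc
  haveI := HeisRing.locallyCompactSpace_skewPart (conjLocal L (IsCMField.complexConj L) v) hσc
  haveI : SecondCountableTopology ↥(HeisRing.fixedPart (conjLocal L (IsCMField.complexConj L) v)) := TopologicalSpace.Subtype.secondCountableTopology _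
  haveI : SecondCountableTopology ↥(HeisRing.skewPart (conjLocal L (IsCMField.complexConj L) v)) := TopologicalSpace.Subtype.secondCountableTopology _
  -- names
  set E : LocalRing L v → ℂ := fun r : LocalRing L v => if h : IsUnit r then ((χ₁ h.unit : ℂˣ) : ℂ) else 0 with hEdef
  set c : _ := Valued.v r with hcdef
  set A : Set (LocalRing L v) := {b | Valued.v ((b - 1 - t₀) w) ≤ c} with hAdef
  set P : Set ↥(HeisRing.fixedPart (conjLocal L (IsCMField.complexConj L) v)) := {a | Valued.v (((a : LocalRing L v) - 1) w) ≤ c} with hPdef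
  set Y : Set ↥(HeisRing.skewPart (conjLocal L (IsCMField.complexConj L) v)) := {y | Valued.v (((y : LocalRing L v) - t₀) w) ≤ c} with hYdef
  set Φ : ℂ := ∫ y in Y, E (1 + (y : LocalRing L v)) ∂μY with hΦdef
  -- `|1 + t₀|_w = 1`
  have h10 : Valued.v ((1 + t₀) w) = 1 := by
    rw [valued_add_apply_eq_max L v w hw h2w (by rw [map_one]) ht₀, Pi.one_apply, map_one, max_eq_left ht₀1]
  -- valuation bookkeeping
  have hval1 : ∀ b : LocalRing L v, Valued.v ((b - 1) w) ≤ c → Valued.v (b w) = 1 := fun b hb => by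
    have h : b w = 1 + (b - 1) w := by rw [Pi.sub_apply, Pi.one_apply, add_sub_cancel]
    rw [h]; exact Valuation.map_one_add_of_lt _ (lt_of_le_of_lt hb hr1)
  have hvalA : ∀ b : LocalRing L v, Valued.v ((b - 1 - t₀) w) ≤ c → Valued.v (b w) = 1 := fun b hb => by
    have h : b w = (1 + t₀) w + (b - 1 - t₀) w := by simp only [Pi.sub_apply, Pi.add_apply, Pi.one_apply]; ring
    have hlt : Valued.v ((b - 1 - t₀) w) < Valued.v ((1 + t₀) w) := by rw [h10]; exact lt_of_le_of_lt hb hr1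
    rw [h, Valuation.map_add_eq_of_lt_left _ hlt, h10]
  have hstep : ∀ (u : (LocalRing L v)ˣ) (b : LocalRing L v), Valued.v (((u : LocalRing L v) - 1) w) ≤ c → Valued.v ((b - 1 - t₀) w) ≤ c →
      Valued.v (((u : LocalRing L v) * b - 1 - t₀) w) ≤ c := fun u b hu hb => by
    have h : ((u : LocalRing L v) * b - 1 - t₀) w = (u : LocalRing L v) w * ((b - 1 - t₀) w) + ((u : LocalRing L v) - 1) w * ((1 + t₀) w) := by
      simp only [Pi.sub_apply, Pi.mul_apply, Pi.add_apply, Pi.one_apply]; ring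
    rw [h]
    refine (Valuation.map_add _ _ _).trans (max_le ?_ ?_)
    · rw [map_mul, hval1 _ hu, one_mul]; exact hb
    · rw [map_mul, h10, mul_one]; exact hu
  have hu₀inv : Valued.v ((((u₀⁻¹ : (LocalRing L v)ˣ) : LocalRing L v) - 1) w) ≤ c := by
    have h : (((u₀⁻¹ : (LocalRing L v)ˣ) : LocalRing L v) - 1) w = -((((u₀⁻¹ : (LocalRing L v)ˣ) : LocalRing L v) w) * (((u₀ : LocalRing L v) - 1) w)) := by
      have h1 := units_apply_mul_inv_apply L v u₀ w
      simp only [Pi.sub_apply, Pi.one_apply]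
      linear_combination h1
    rw [h, Valuation.map_neg, map_mul, valued_units_inv_apply_eq_one L v (hval1 _ hu₀), one_mul]; exact hu₀
  -- the set `A` is Borel, made of units of absolute value one, and `u₀`-invariant
  have hA : MeasurableSet A := by
    have h : A = (fun b : LocalRing L v => (b - 1 - t₀) w) ⁻¹' {z : w.1.adicCompletion L | Valued.v z ≤ c} := rfl
    rw [h]
    exact ((isClosed_setOf_valued_le_valued L v w r).preimage
      ((continuous_apply w).comp ((continuous_id.sub continuous_const).sub continuous_const))).measurableSet
  have hA1 : ∀ b ∈ A, Valued.v (b w) = 1 := fun b hb => hvalA b hb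
  have hAu : ∀ b : LocalRing L v, (u₀ : LocalRing L v) * b ∈ A ↔ b ∈ A := fun b => by
    refine ⟨fun h => ?_, fun h => hstep u₀ b hu₀ h⟩
    have h' := hstep u₀⁻¹ ((u₀ : LocalRing L v) * b) hu₀inv h
    rwa [← mul_assoc, Units.inv_mul, one_mul] at h'
  have hu₀' : ∀ w' : PlacesOver L v, Valued.v ((u₀ : LocalRing L v) w') = 1 := forall_placesOver_of_apply L v w hw (hval1 _ hu₀)
  -- the product structure of `A` in `R = R⁺ ⊕ R⁻`
  have hP1 : P ⊆ {a | Valued.v ((a : LocalRing L v) w) ≤ 1} := fun a ha => (hval1 _ ha).le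
  have hY1 : Y ⊆ {y | Valued.v ((y : LocalRing L v) w) ≤ 1} := fun y hy => by
    have e : (y : LocalRing L v) w = ((y : LocalRing L v) - t₀) w + t₀ w := by rw [Pi.sub_apply, sub_add_cancel]
    show Valued.v ((y : LocalRing L v) w) ≤ 1
    rw [e]; exact (Valuation.map_add _ _ _).trans (max_le (le_trans hy hr1.le) ht₀1)
  have hAPY : ∀ (a : ↥(HeisRing.fixedPart (conjLocal L (IsCMField.complexConj L) v))) (y : ↥(HeisRing.skewPart (conjLocal L (IsCMField.complexConj L) v))),
      (a : LocalRing L v) + (y : LocalRing L v) ∈ A ↔ a ∈ P ∧ y ∈ Y := fun a y => by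
    have ha : conjLocal L (IsCMField.complexConj L) v ((a : LocalRing L v) - 1) = (a : LocalRing L v) - 1 := by
      rw [map_sub, map_one, (HeisRing.mem_fixedPart_iff _ _).1 a.2]
    have hy : conjLocal L (IsCMField.complexConj L) v ((y : LocalRing L v) - t₀) = -((y : LocalRing L v) - t₀) := by
      rw [map_sub, (HeisRing.mem_skewPart_iff _ _).1 y.2, ht₀, neg_sub_neg, neg_sub]
    have hmax := valued_add_apply_eq_max L v w hw h2w ha hy
    show Valued.v (((a : LocalRing L v) + (y : LocalRing L v) - 1 - t₀) w) ≤ c ↔ _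
    rw [show (a : LocalRing L v) + (y : LocalRing L v) - 1 - t₀ = ((a : LocalRing L v) - 1) + ((y : LocalRing L v) - t₀) by ring, hmax, max_le_iff]
    rfl
  -- an additive Haar measure `μ⁺` on `R⁺` (transported from `μ⁻` by a skew unit of `R`) and the Haar measure `(μ⁺ ⊗ μ⁻) ∘ ringDecomp⁻¹` on `R`
  obtain ⟨δ, hδ⟩ := exists_conjLocal_skew_unit L v
  set eP := HeisRing.mulSkewUnit (conjLocal L (IsCMField.complexConj L) v) δ hδ with hePdef
  set μP : Measure ↥(HeisRing.fixedPart (conjLocal L (IsCMField.complexConj L) v)) := μY.map eP.symm with hμPdef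
  haveI hμP : μP.IsAddHaarMeasure := ContinuousAddEquiv.isAddHaarMeasure_map μY eP.symm
  haveI : (μP.prod μY).IsAddHaarMeasure := inferInstance
  haveI : ((μP.prod μY).map (HeisRing.ringDecomp (conjLocal L (IsCMField.complexConj L) v) (conjLocal_conjLocal_cm L v) hσc).symm).IsAddHaarMeasure :=
    ContinuousAddEquiv.isAddHaarMeasure_map (μP.prod μY) (HeisRing.ringDecomp (conjLocal L (IsCMField.complexConj L) v) (conjLocal_conjLocal_cm L v) hσc).symm
  -- §1 orthogonality, §2 decomposition, §3 constancy of the fibre (PRINCIPAL form, translated ball)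
  have horth := integral_indicator_dite_eq_zero_of_mul_mem_iff L v w hw
    ((μP.prod μY).map (HeisRing.ringDecomp (conjLocal L (IsCMField.complexConj L) v) (conjLocal_conjLocal_cm L v) hσc).symm) χ₁ h₁ u₀ hu₀' hχ hA hAu
  rw [integral_indicator_dite_map_ringDecomp_eq_of_prod L v w hw χ₁ h₁ μP μY hA hA1 hP1 hY1 hAPY] at horth
  have hfib : ∀ a : ↥(HeisRing.fixedPart (conjLocal L (IsCMField.complexConj L) v)),
      P.indicator (fun a' => ∫ y in Y, E ((a' : LocalRing L v) + (y : LocalRing L v)) ∂μY) a = P.indicator (fun _ => Φ) a := fun a => by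
    by_cases ha : a ∈ P
    · rw [Set.indicator_of_mem ha, Set.indicator_of_mem ha]
      exact setIntegral_skewBallTranslate_dite_add_eq_of_fixedPrincipal L v w hw μY h2w χ₁ hfixP r hr1 ht₀1 ((HeisRing.mem_fixedPart_iff _ _).1 a.2) ha
    · rw [Set.indicator_of_notMem ha, Set.indicator_of_notMem ha]
  have hA' : MeasurableSet {b : LocalRing L v | Valued.v ((b - 1) w) ≤ c} := by
    have h : {b : LocalRing L v | Valued.v ((b - 1) w) ≤ c} = (fun b : LocalRing L v => (b - 1) w) ⁻¹' {z : w.1.adicCompletion L | Valued.v z ≤ c} := rfl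
    rw [h]
    exact ((isClosed_setOf_valued_le_valued L v w r).preimage ((continuous_apply w).comp (continuous_id.sub continuous_const))).measurableSet
  have hPm : MeasurableSet P := measurable_subtype_coe hA'
  rw [integral_congr_ae (Filter.Eventually.of_forall hfib), integral_indicator_const Φ hPm, Complex.real_smul] at horth
  -- `0 < μ⁺(P) < ∞`
  have hPo : IsOpen P := by
    have h : P = (fun a : ↥(HeisRing.fixedPart (conjLocal L (IsCMField.complexConj L) v)) => ((a : LocalRing L v) - 1) w) ⁻¹'
        {z : w.1.adicCompletion L | Valued.v z ≤ c} := rfl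
    rw [h]
    exact (isOpen_setOf_valued_le_valued L v w hr0).preimage ((continuous_apply w).comp (continuous_subtype_val.sub continuous_const))
  have hPne : P.Nonempty := ⟨⟨1, (HeisRing.mem_fixedPart_iff _ _).2 (map_one _)⟩, by
    show Valued.v (((1 : LocalRing L v) - 1) w) ≤ c; rw [sub_self, Pi.zero_apply, map_zero]; exact _root_.zero_le⟩
  have hPfin : μP P ≠ ⊤ := by
    have hBPc : IsCompact {a : ↥(HeisRing.fixedPart (conjLocal L (IsCMField.complexConj L) v)) | Valued.v ((a : LocalRing L v) w) ≤ 1} :=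
      (HeisRing.isClosed_fixedPart _ hσc).isClosedEmbedding_subtypeVal.isCompact_preimage (isCompact_setOf_valued_apply_le_one L v w hw)
    exact ((measure_mono hP1).trans_lt hBPc.measure_lt_top).ne
  have hPpos : (μP.real P : ℂ) ≠ 0 := by
    rw [Ne, Complex.ofReal_eq_zero, measureReal_def, ENNReal.toReal_eq_zero_iff, not_or]
    exact ⟨(hPo.measure_pos μP hPne).ne', hPfin⟩
  exact (mul_eq_zero.1 horth).resolve_left hPpos

/-! ## §4 The same in the C-PACK currency: radius `|Π|ᵐ` for a uniformiser `Π` of `L_w`, witness letters `u₁ hu₁ hχu₁` of ★ p863496 -/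

open scoped Classical in
include hw in
/-- **THE COSET VANISHING AT RADIUS `|Π|ᵐ`** (`1 ≤ m`) in the C-pack currency of ★ p863496: a unit `u₁` with `|(u₁)_{w′} − 1| ≤ |Π|ᵐ` at every `w′` and `χ₁ u₁ ≠ 1`
(the conductor's sharp witness at level `n − 1` serves every `m ≤ n − 1`) makes `∫_{|y − t₀|_w ≤ |Π|ᵐ} E(1 + y) dμ⁻ = 0` for every skew centre `t₀` with `|t₀|_w ≤ 1` — the
cosets `t₀ + E⁻_{m}` of PAPER P-ram-1 §1 (P3) (`m ≤ n − 1`; the shells `m′ = m − 2 ≤ n − 3` of the ramified Casselman pair). [cite: Keys1984, §7 Theorem (2) p. 126] [cite: Roche1998, §3] -/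
theorem setIntegral_skewBallTranslate_pow_dite_one_add_eq_zero (h2w : Valued.v (2 : w.1.adicCompletion L) = 1)
    (χ₁ : (LocalRing L v)ˣ →* ℂˣ) (h₁ : Continuous fun x => ((χ₁ x : ℂˣ) : ℂ))
    (hfixP : ∀ u : (LocalRing L v)ˣ, (∀ w' : PlacesOver L v, Valued.v (((u : LocalRing L v) w') - 1) < 1) →
      conjLocal L (IsCMField.complexConj L) v (u : LocalRing L v) = u → χ₁ u = 1)
    {ϖ : w.1.adicCompletion L} (hϖ : Valued.v ϖ = WithZero.exp (-1 : ℤ)) {m : ℕ} (hm : 1 ≤ m)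
    {t₀ : LocalRing L v} (ht₀ : conjLocal L (IsCMField.complexConj L) v t₀ = -t₀) (ht₀1 : Valued.v (t₀ w) ≤ 1)
    (u₁ : (LocalRing L v)ˣ) (hu₁ : ∀ w' : PlacesOver L v, Valued.v (((u₁ : LocalRing L v) w') - 1) ≤ Valued.v ϖ ^ m) (hχu₁ : χ₁ u₁ ≠ 1) :
    ∫ y in {y : ↥(HeisRing.skewPart (conjLocal L (IsCMField.complexConj L) v)) | Valued.v (((y : LocalRing L v) - t₀) w) ≤ Valued.v ϖ ^ m},
        (fun r : LocalRing L v => if h : IsUnit r then ((χ₁ h.unit : ℂˣ) : ℂ) else 0) (1 + (y : LocalRing L v)) ∂μY = 0 := by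
  have hpow : Valued.v (ϖ ^ m) = Valued.v ϖ ^ m := map_pow _ _ _
  have h0 : Valued.v ϖ ^ m ≠ 0 := pow_ne_zero _ (by rw [hϖ]; exact WithZero.exp_ne_zero)
  have h1 : Valued.v ϖ ^ m < 1 :=
    (pow_lt_one_iff (by omega)).2 (by rw [hϖ, ← WithZero.exp_zero, WithZero.exp_lt_exp]; norm_num)
  have h := setIntegral_skewBallTranslate_dite_one_add_eq_zero_of_level_of_fixedPrincipal L v w hw μY h2w χ₁ h₁ hfixP (ϖ ^ m)
    (by rw [hpow]; exact h0) (by rw [hpow]; exact h1) ht₀ ht₀1 u₁ (by rw [hpow]; exact hu₁ w) hχu₁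
  rwa [hpow] at h

open scoped Classical in
include hw in
/-- **`χ₁⁻¹`-form at radius `|Π|ᵐ`** (the big-cell integrand is `χ₁(σz)⁻¹`). [cite: Keys1984, §7 Theorem (2) p. 126] -/
theorem setIntegral_skewBallTranslate_pow_diteInv_one_add_eq_zero (h2w : Valued.v (2 : w.1.adicCompletion L) = 1)
    (χ₁ : (LocalRing L v)ˣ →* ℂˣ) (h₁ : Continuous fun x => ((χ₁ x : ℂˣ) : ℂ))
    (hfixP : ∀ u : (LocalRing L v)ˣ, (∀ w' : PlacesOver L v, Valued.v (((u : LocalRing L v) w') - 1) < 1) →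
      conjLocal L (IsCMField.complexConj L) v (u : LocalRing L v) = u → χ₁ u = 1)
    {ϖ : w.1.adicCompletion L} (hϖ : Valued.v ϖ = WithZero.exp (-1 : ℤ)) {m : ℕ} (hm : 1 ≤ m)
    {t₀ : LocalRing L v} (ht₀ : conjLocal L (IsCMField.complexConj L) v t₀ = -t₀) (ht₀1 : Valued.v (t₀ w) ≤ 1)
    (u₁ : (LocalRing L v)ˣ) (hu₁ : ∀ w' : PlacesOver L v, Valued.v (((u₁ : LocalRing L v) w') - 1) ≤ Valued.v ϖ ^ m) (hχu₁ : χ₁ u₁ ≠ 1) :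
    ∫ y in {y : ↥(HeisRing.skewPart (conjLocal L (IsCMField.complexConj L) v)) | Valued.v (((y : LocalRing L v) - t₀) w) ≤ Valued.v ϖ ^ m},
        (fun r : LocalRing L v => if h : IsUnit r then ((χ₁⁻¹ h.unit : ℂˣ) : ℂ) else 0) (1 + (y : LocalRing L v)) ∂μY = 0 := by
  have h₁' : Continuous fun x => ((χ₁⁻¹ x : ℂˣ) : ℂ) := by
    have h : (fun x => ((χ₁⁻¹ x : ℂˣ) : ℂ)) = fun x => (((χ₁ x : ℂˣ) : ℂ))⁻¹ := by
      funext x; rw [MonoidHom.inv_apply, Units.val_inv_eq_inv_val]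
    rw [h]; exact h₁.inv₀ fun x => Units.ne_zero _
  have hfixP' : ∀ u : (LocalRing L v)ˣ, (∀ w' : PlacesOver L v, Valued.v (((u : LocalRing L v) w') - 1) < 1) →
      conjLocal L (IsCMField.complexConj L) v (u : LocalRing L v) = u → χ₁⁻¹ u = 1 := fun u hu hσu => by
    rw [MonoidHom.inv_apply, hfixP u hu hσu, inv_one]
  have hχ' : χ₁⁻¹ u₁ ≠ 1 := by rwa [MonoidHom.inv_apply, Ne, inv_eq_one]
  exact setIntegral_skewBallTranslate_pow_dite_one_add_eq_zero L v w hw μY h2w χ₁⁻¹ h₁' hfixP' hϖ hm ht₀ ht₀1 u₁ hu₁ hχ'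

end SkewBallTranslate

end Summit.HodgeConjecture.HodgeConjecture.R90.S1.BposRamSkewLineCayley

end
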